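import Summits.QuantumFields.YangMills.Theses.UnitScaleTilt
import Literature.MathematicalPhysics.QuantumFieldTheory.Balaban1983to89.T3SplitLog
import Literature.MathematicalPhysics.QuantumFieldTheory.Balaban1983to89.T3UpperLiftSplitLog
import Literature.MathematicalPhysics.QuantumFieldTheory.Balaban1983to89.T3ExistSplit
import Summits.QuantumFields.YangMills.Theorems.UnitScaleTiltMinimiserStabilityRegPrAvgActionDefect
import Summits.QuantumFields.YangMills.Theorems.UnitScaleTiltMinimiserStabilityRegPrAvgCurvGrad
import Summits.QuantumFields.YangMills.Theorems.UnitScaleTiltMinimiserStabilityRegPrAttainmentOfLeaves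
import Summits.QuantumFields.YangMills.Theorems.UnitScaleTiltMinimiserStabilityRegPrSmoothLift
import Summits.QuantumFields.YangMills.Theorems.UnitScaleTiltMinimiserStabilityRegPrCritCurvGradLog
import Summits.QuantumFields.YangMills.Theorems.UnitScaleTiltMinimiserStabilityRegPrProp8Iter
import HarnessLib

/-!
# LAYER-4 BIRTH v7 CANDIDATE of the K1 crux child «MinimiserStabilityRegPr» (stmt-QuantumFields-19200) = registered v6 (636b1fa3b005b89b) WITH
# STUB V2 `stub_prop8` REPLACED BY THE ONE-STEP HALVING STUB `stub_halvingStep` (OWNER RULING g20-№2 (B)) and V4′ `stub_critCurvGradLog` LANDED (p511133);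
# stubs {stub_halvingStep, stub_prop7From14} — seat ym3-torus-p1 gen 14; a CANDIDATE for the owner's five checks, not registered by this seat
#
# v7 CHANGE (HOME/UV3-NODE.md §23; OWNER-RULING-g20-2.md (B1)–(B2)): print proves Prop. 8 by the HALVING STEP of Sect. F iterated (p. 304 «hence U_k belongs to the
# space (2) with max{B₃ε₁, ½ε₀} instead of ε₀ … If ½ε₀ > B₃ε₁, then we apply again the whole reasoning with ½ε₀ instead of ε₀. We continue this way until we reach the
# bound B₃ε₁»); the iteration is kernel-checked in the tree (lit-balaban `B11Prop8Assembly.prop8Printed_of_halvingStep`, native `T3Thm1CarrierNative` §5) and glued in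
# the stub's shape by p1 g14's `Theorems/UnitScaleTiltMinimiserStabilityRegPrProp8Iter` (`Prop8Iter.prop8_of_halvingLiteral`), so V2 becomes the ONE-STEP stub
# `stub_halvingStep` = `Prop8Printed`'s binders with the conclusion halved (`InU (max (B₃ε₁) (ε₀/2)) U`), and `landed_prop8` discharges the v6 text of V2 BY NAME.
# B₃ stays ONE existential per L shared with V3/V4′ (unchanged composition `variational_of_leaves_log` / `MinimiserStabilityRegPr_of`).
# (v6 header kept below for the record.)
# was: LAYER-4 BIRTH v6 CANDIDATE of the K1 crux child «MinimiserStabilityRegPr» (stmt-QuantumFields-19200) — v5 (98cb23610ad721f5) WITH STUB V4 `stub_sectF`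
# REPLACED BY THE LOG-LIPSCHITZ STUB `stub_critCurvGradLog` (seat ym3-torus-p1 gen 12, finding F-g12-1; a CANDIDATE for the owner / lead — not registered
# by this seat)

WHY (HOME/UV3-NODE.md §21; evidence #36 `evidence-V4-beta1-logdivergence.md` on 19200): v5's V4 = `B11.SectFPrinted B₃ (famX L)` is, at the T³ carrier, EXACTLY
the `β = β₀ = 1` clause of [Balaban1985Variational] (9) for critical configurations (`T3Thm1CarrierNative.sectFPrinted_famX_iff`) — a pointwise bound on the
curvature gradient with a constant fixed before `K − n`.  Print does not derive it ([Balaban1985RegularSpaces] Thm 2 (1.36) is `β₀ < 1`; p. 83 «Such information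
is unavailable for the second order derivatives»), and for the constrained minimiser it fails like `(K − n)·log L` (constraint force jumping across unit-block faces;
cell numerics kit j267781/j267782).  Every use the line makes of the bound tolerates a factor polynomial in `K − n` because `ε₁ = B₃·θBal(⌊K/m⌋)` decays geometrically:
so V4 is replaced by the log-Lipschitz statement `CritCurvGradLogAt` (`B₄ε₁ ↦ B₄ε₁((K−n)+1)`; = (9) for every `β < 1` with a rate `B₄(β) = O((1−β)⁻¹)`; TRUE by the
Calderón–Zygmund endpoint for the linearised Euler–Lagrange system, located-unprinted in its rate), and the three compositions are the re-derived ones of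
`T3CurvGradLog` / `T3SplitLog` / `T3UpperLiftSplitLog` (K-dependent windows closed by `exists_gamma_forall_Kmul_θBal_le`).

Stubs (sorries ONLY here) — v7: `stub_halvingStep` (V2′, the one-step halving, NEW), `stub_prop7From14` (V3, verbatim v5).  LANDED by name: `stub_critCurvGradLog` (V4′, p511133), `landed_prop8` (V2 ⇐ V2′, p1 g14 `Prop8Iter`).  Landed inputs consumed by
name: `SmoothLift.stub_smoothLift` (p466834), `AvgCurvGrad.stub_avgCurvGrad` (p440643), `AvgActionDefect.stub_avgActionDefect` (p437535), `Variational.minSixAttainedAt_of_prop7_prop8`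
(p478378), `T3Thm1Carrier.minimisersIn8At_of_prop8` (p428575).  Composition `MinimiserStabilityRegPr_of` concludes the route decl BY NAME, no sorry of its own.
-/

noncomputable section

open MeasureTheory Filter Topology
open scoped Matrix.Norms.L2Operator
open Literature.MathematicalPhysics.QuantumFieldTheory.Balaban1983to89
open Literature.MathematicalPhysics.QuantumFieldTheory.Balaban1983to89.T3ContinuumYM3Torus
open Literature.MathematicalPhysics.QuantumFieldTheory.Balaban1983to89.T3UnitLawDensityEML (ℰp measurableE_ℰp)
open Literature.MathematicalPhysics.QuantumFieldTheory.Balaban1983to89.T3UnitScaleTilt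
open Literature.MathematicalPhysics.QuantumFieldTheory.Balaban1983to89.T3TiltDescent
open Literature.MathematicalPhysics.QuantumFieldTheory.Balaban1983to89.T3CruxEstimates
open Literature.MathematicalPhysics.QuantumFieldTheory.Balaban1983to89.T3ConstrainedMinimiser
open Literature.MathematicalPhysics.QuantumFieldTheory.Balaban1983to89.T3DescentFibreTower
open Literature.MathematicalPhysics.QuantumFieldTheory.Balaban1983to89.T3MinimiserStabilityReduction
open Literature.MathematicalPhysics.QuantumFieldTheory.Balaban1983to89.T3RegularMinimiser
open Literature.MathematicalPhysics.QuantumFieldTheory.Balaban1983to89.T3PrintedRegularMinimiser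
open Literature.MathematicalPhysics.QuantumFieldTheory.Balaban1983to89.T3PrintedRegularMinimiserReduction
open Literature.MathematicalPhysics.QuantumFieldTheory.Balaban1983to89.T3PrintedMinimiserExistence
open Literature.MathematicalPhysics.QuantumFieldTheory.Balaban1983to89.T3LowerAlongMinimisersSplit
open Literature.MathematicalPhysics.QuantumFieldTheory.Balaban1983to89.T3AvgDivergenceSplit
open Literature.MathematicalPhysics.QuantumFieldTheory.Balaban1983to89.T3UpperAlongMinimisersSplit
open Literature.MathematicalPhysics.QuantumFieldTheory.Balaban1983to89.T3UpperLiftSplit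
open Literature.MathematicalPhysics.QuantumFieldTheory.Balaban1983to89.T3LowerActionSplit
open Literature.MathematicalPhysics.QuantumFieldTheory.Balaban1983to89.T3ExistSplit
open Literature.MathematicalPhysics.QuantumFieldTheory.Balaban1983to89.T3Thm1Carrier
open Literature.MathematicalPhysics.QuantumFieldTheory.Balaban1983to89.T3CurvGradLog
open Literature.MathematicalPhysics.QuantumFieldTheory.Balaban1983to89.T3SplitLog
open Literature.MathematicalPhysics.QuantumFieldTheory.Balaban1983to89.T3UpperLiftSplitLog
open Literature.MathematicalPhysics.QuantumFieldTheory.Balaban1983to89.B11 (Prop8Printed)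

namespace Summit.QuantumFields.YangMills.Cruxes.MinimiserStabilityRegPr.BirthLayer4v7

/-! ## §1 Registered stubs (each a genuine lemma of the line; sorries live ONLY here) -/

/-- STUB V2′ — THE ONE-STEP HALVING of [Balaban1985Variational] Sect. F at the d = 3 carriers (p. 304, verbatim: «hence U_k belongs to the space (2) with
max{B₃ε₁, ½ε₀} instead of ε₀»; Sect. F p. 300: «We will use only the fact that they are critical configurations of the functional (5) and that they belong to the
spaces (6) with ε₀ sufficiently small»), for SOME B₃ > 4 and a₅ > 0: `Prop8Printed`'s binders with the conclusion HALVED — for every member `i` (block size `L`,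
heights `n < K`), `0 < ε₁`, every (7)-datum `V`, every `U ∈ 𝔘_k(ε₀) ∩ 𝔅_k(V)` critical in reading R2, `ε₀ ≤ a₅` ⇒ `U ∈ 𝔘_k(max{B₃ε₁, ½ε₀})` (OWNER RULING g20-№2 (B1)).
Equivalent readings (p1 g14 `Prop8Iter.halvingLiteral_iff_halvingStep` / `…_iff_native`): `∀ i, B11Prop8Assembly.HalvingStep (famX L i) B₃ a₅`,
`T3Thm1CarrierNative.HalvingNativeAt L a₅ B₃`; reducible to MINIMISERS over (6)(ε₀), `0 < ε₀ ≤ a₅` (`Prop8Iter.halvingLiteral_of_minimisers`).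
Content (work map, owner (B3)): [Balaban1985RegularSpaces] Thm 2 gauge (152), the flat constrained propagators of [Balaban1984PropagatorsII] (2.47)–(2.51) (162)–(164),
the datum bound (160), smallness (165)–(168). XL. [cite: Balaban1985Variational, Sect. F p.304 before Prop. 8] -/
theorem stub_halvingStep : ∀ (L : ℕ), 1 < L → ∃ B₃ : ℝ, 4 < B₃ ∧ ∃ a₅ : ℝ, 0 < a₅ ∧
    ∀ (i : Idx L) (ε₀ ε₁ : ℝ), 0 < ε₁ → ∀ (V : (famX L i).Bdry) (U : (famX L i).Cfg), (famX L i).Reg7 ε₁ V → (famX L i).InU ε₀ U →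
      (famX L i).InB V U → (famX L i).IsCritical V U → ε₀ ≤ a₅ → (famX L i).InU (max (B₃ * ε₁) (ε₀ / 2)) U := by
  sorry

/-- LANDED V2 (the v6 text of `stub_prop8`, now a theorem modulo V2′) — [Balaban1985Variational] PROPOSITION 8 at the d = 3 carriers for the SAME B₃ > 4, by the
kernel-checked halving iteration: p1 g14's `Summit.QuantumFields.YangMills.Theorems.Prop8Iter.prop8_of_halvingLiteral` over lit-balaban's
`B11Prop8Assembly.prop8Printed_of_halvingStep` («We continue this way until we reach the bound B₃ε₁»). [cite: Balaban1985Variational, Prop. 8 p.304] -/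
theorem landed_prop8 : ∀ (L : ℕ), 1 < L → ∃ B₃ : ℝ, 4 < B₃ ∧ Prop8Printed B₃ (famX L) :=
  Summit.QuantumFields.YangMills.Theorems.Prop8Iter.prop8_of_halvingLiteral stub_halvingStep

/-- STUB V3 — [Balaban1985Variational] PROPOSITION 7 FROM A BACKGROUND (14) at the d = 3 carriers, PRINTED (p. 299; Sects. B–E), for every B₃ > 4 (verbatim v5).
XL. [cite: Balaban1985Variational, Prop. 7 p.299] -/
theorem stub_prop7From14 : ∀ (L : ℕ), 1 < L → ∀ B₃ : ℝ, 4 < B₃ →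
    ∃ a₀ a₁' O₁ : ℝ, 0 < a₀ ∧ 0 < a₁' ∧ 1 ≤ O₁ ∧ ∀ (i : Idx L) (ε₀ ε₁ : ℝ), 0 < ε₁ → ∀ V : (famX L i).Bdry, (famX L i).Reg7 ε₁ V →
      ∀ U₀ : (famX L i).Cfg, (famX L i).InU ((L : ℝ) ^ 3 * B₃ * ε₁) U₀ → (famX L i).InB V U₀ →
        (ε₀ ≤ a₀ → B₃ * ε₁ ≤ ε₀ → (famX L i).AtMostOneCriticalOrbit ε₀ V) ∧
        (ε₁ ≤ a₁' → ∃ U : (famX L i).Cfg, (famX L i).OnMinimalOrbit (O₁ * (L : ℝ) ^ 3 * B₃ * ε₁) V U) := by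
  sorry

/-- LANDED V4′ — the log-Lipschitz curvature gradient of critical configurations in (8), p1 g13's
`Summit.QuantumFields.YangMills.Theorems.CritCurvGradLog.stub_critCurvGradLog` (p511133; proved for EVERY (8)-regular configuration, `regPr_curvGrad_lt`;
cell memo HOME/UV3-NODE.md §22). [cite: Balaban1985Variational, Thm 1 (9) p.279; Balaban1985RegularSpaces, Thm 2 (1.36) p.82] -/
theorem stub_critCurvGradLog : ∀ (L : ℕ), 1 < L → ∀ B₃ : ℝ, 4 < B₃ → ∃ a₁ B₄ : ℝ, 0 < a₁ ∧ 0 < B₄ ∧ CritCurvGradLogAt L a₁ B₃ B₄ :=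
  Summit.QuantumFields.YangMills.Theorems.CritCurvGradLog.stub_critCurvGradLog

/-! ## §2 Landed inputs, by name -/

/-- LANDED — located gap G-K1a-2′ (smooth exact one-step lift), v4's `stub_smoothLift`, p466834. [cite: King1986, (A.5) p.676] -/
theorem landed_smoothLift : ∀ (L : ℕ), ∃ C₁ C₂ c : ℝ, 0 < C₁ ∧ 0 ≤ C₂ ∧ 0 < c ∧ SmoothLiftAt L C₁ C₂ c :=
  Summit.QuantumFields.YangMills.Theorems.SmoothLift.stub_smoothLift

/-- LANDED — located gap G-K1a-3a′ (first-order regularity of the one-step average), p440643. [cite: Balaban1985Averaging, Prop. 3 (122)-(123) p.36] -/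
theorem landed_avgCurvGrad : ∀ (L : ℕ), ∃ C₁ C₂ c : ℝ, 0 ≤ C₁ ∧ 0 < C₂ ∧ 0 < c ∧ AvgCurvGradAt L C₁ C₂ c :=
  Summit.QuantumFields.YangMills.Theorems.AvgCurvGrad.stub_avgCurvGrad

/-- LANDED — located gap G-K1a-3b′ (per-configuration averaging action defect), p437535. [cite: Federbush1987PhaseCellIII, Thm 4.3 (4.5) p.299] -/
theorem landed_avgActionDefect : ∀ (L : ℕ), ∃ C₂ c : ℝ, 0 ≤ C₂ ∧ 0 < c ∧ AvgActionDefectAt L C₂ c :=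
  Summit.QuantumFields.YangMills.Theorems.AvgActionDefect.stub_avgActionDefect

/-- **THE VARIATIONAL DATA FROM THE THREE LEAVES** (no sorry of its own): attainment over (6) from V3 ∧ V2 (p478378 `minSixAttainedAt_of_prop7_prop8`),
`MinimisersIn8At` from V2 (p428575 `minimisersIn8At_of_prop8`), and the log-Lipschitz minimiser schema from V4′ ∧ V2 (`minimiserCurvGradLogAt_of_crit`).
[cite: Balaban1985Variational, Thm 1 p.279, Prop 7 p.299, Prop 8 p.304] -/
theorem variational_of_leaves_log (L : ℕ) (hL : 1 < L) :
    ∃ â₀ â₁ a₀ a₁ B₃ B₄ : ℝ, 0 < â₀ ∧ 0 < â₁ ∧ 0 < a₀ ∧ 0 < a₁ ∧ 0 < B₃ ∧ 0 < B₄ ∧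
      MinSixAttainedAt L â₀ â₁ B₃ ∧ MinimisersIn8At L a₀ a₁ B₃ ∧ MinimiserCurvGradLogAt L a₀ a₁ B₃ B₄ := by
  obtain ⟨B₃, hB₃, h8⟩ := landed_prop8 L hL
  have h7 := stub_prop7From14 L hL B₃ hB₃
  obtain ⟨a₁, B₄, ha₁, hB₄, hc⟩ := stub_critCurvGradLog L hL B₃ hB₃
  have hB₃0 : 0 < B₃ := by linarith
  obtain ⟨â₀, â₁, hâ₀, hâ₁, hatt⟩ := Summit.QuantumFields.YangMills.Theorems.Variational.minSixAttainedAt_of_prop7_prop8 hL hB₃ h7 h8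
  obtain ⟨a₅, ha₅, h8'⟩ := minimisersIn8At_of_prop8 hB₃0 h8
  exact ⟨â₀, â₁, a₅, a₁, B₃, B₄, hâ₀, hâ₁, ha₅, ha₁, hB₃0, hB₄, hatt, h8' a₁, minimiserCurvGradLogAt_of_crit hB₃0 hc (h8' a₁)⟩

/-! ## §3 The composition — concludes the ROUTE DECL by name, no sorry of its own -/

/-- **`MinimiserStabilityRegPr ⇐ (stub_halvingStep ∧ stub_prop7From14) ∧ landed V4′ `stub_critCurvGradLog` ∧ landed_prop8 (iteration) ∧ landed_smoothLift ∧ landed_avgCurvGrad ∧ landed_avgActionDefect`**: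
EXIST by `T3ExistSplit.hasRegMinimisersPrAt_of_attained`, UPPER by `T3UpperLiftSplitLog.upperAlongRegPrMinimisersAt_of_splitLog'`, LOWER by
`T3SplitLog.lowerAlongRegPrMinimisersAt_of_splitLog'''` (both through the log-Lipschitz schema with K-dependent windows), then
`minimiserStabilityRegPrAt_of_alongRegPrMinimisers`; ε₁ := min of three, m₀ := 10, γ₁ := min of three; `p₀ > 2 > 0`; `L ≤ 1` is vacuous. -/
theorem MinimiserStabilityRegPr_of : Summit.QuantumFields.YangMills.Theses.UnitScaleTilt.MinimiserStabilityRegPr := by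
  intro L
  by_cases hL : 1 < L
  · obtain ⟨â₀, â₁, a₀, a₁, B₃, B₄, hâ₀, hâ₁, ha₀, ha₁, hB₃, hB₄, hatt, hIn8, hgrad⟩ := variational_of_leaves_log L hL
    -- EXIST
    obtain ⟨e₁, he₁, hE⟩ := hasRegMinimisersPrAt_of_attained hâ₀ hâ₁ hB₃ hatt
    -- UPPER
    obtain ⟨C₁, C₂, c, hC₁, hC₂, hc, hlift⟩ := landed_smoothLift L
    obtain ⟨e₂, he₂, hU⟩ := upperAlongRegPrMinimisersAt_of_splitLog' ha₀ ha₁ hB₃ hB₄ hC₁ hC₂ hc hIn8 hgrad hlift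
    -- LOWER
    obtain ⟨D₁, D₂, d, hD₁, hD₂, hd, havg⟩ := landed_avgCurvGrad L
    obtain ⟨E₂, e, hE₂, he, hdef⟩ := landed_avgActionDefect L
    obtain ⟨e₃, he₃, hLo⟩ := lowerAlongRegPrMinimisersAt_of_splitLog''' hL.le ha₀ ha₁ hB₃ hB₄ hD₂ hd hE₂ he hIn8 hgrad havg hdef
    -- the common `ε₁`, `m₀ = 10`, `γ₁`
    refine ⟨min e₁ (min e₂ e₃), lt_min he₁ (lt_min he₂ he₃), fun ε₀ hε hεle => ⟨10, fun m hm b₀ p₀ hb hp => ?_⟩⟩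
    have hε₁ : ε₀ ≤ e₁ := hεle.trans (min_le_left _ _)
    have hε₂ : ε₀ ≤ e₂ := hεle.trans ((min_le_right _ _).trans (min_le_left _ _))
    have hε₃ : ε₀ ≤ e₃ := hεle.trans ((min_le_right _ _).trans (min_le_right _ _))
    have hm2 : 2 ≤ m := le_trans (by norm_num) hm
    have hp0 : 0 < p₀ := lt_trans two_pos hp
    obtain ⟨γa, hγa, hA⟩ := hE ε₀ hε hε₁ m hm2 b₀ p₀ hb
    obtain ⟨γb, hγb, hB⟩ := hU ε₀ hε hε₂ m hm b₀ p₀ hb hp0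
    obtain ⟨γc, hγc, hC⟩ := hLo ε₀ hε hε₃ m hm b₀ p₀ hb hp0
    refine ⟨min γa (min γb γc), lt_min hγa (lt_min hγb hγc), fun F γ hFL hγ hγle => ?_⟩
    have hγa' : γ ≤ γa := hγle.trans (min_le_left _ _)
    have hγb' : γ ≤ γb := hγle.trans ((min_le_right _ _).trans (min_le_left _ _))
    have hγc' : γ ≤ γc := hγle.trans ((min_le_right _ _).trans (min_le_right _ _))
    exact minimiserStabilityRegPrAt_of_alongRegPrMinimisers hγ.le (hA F γ hFL hγ hγa') (hB F γ hFL hγ hγb') (hC F γ hFL hγ hγc')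
  · -- no member of the family has block size `L ≤ 1`
    exact ⟨1, one_pos, fun ε₀ _ _ => ⟨0, fun m _ b₀ p₀ _ _ => ⟨1, one_pos, fun F γ hFL _ _ => absurd (hFL ▸ F.hL.2) hL⟩⟩⟩

end Summit.QuantumFields.YangMills.Cruxes.MinimiserStabilityRegPr.BirthLayer4v7

end
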